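import Mathlib
import Summits.ValiantsHypothesis.ValiantsHypothesis.Theses.NewtonUnitEquations
import Summits.ValiantsHypothesis.ValiantsHypothesis.Theorems.DissociatedFixedK.Negative.LoadBearing
import Literature.Computability.Complexity.PoweringConstruction
import Literature.Uncategorized.DissociatedFixedKUniformC

/-!
# `DissociatedFixedK` (stmt-ValiantsHypothesis-5907) — the uniform-exponent strengthening is FALSE (negative lane, part 2)

`not_dissociatedFixedKUniformC`: the crux
`Summit.ValiantsHypothesis.ValiantsHypothesis.Theses.NewtonUnitEquations.DissociatedFixedK` with its
quantifiers `∀ k, ∃ C` swapped to `∃ C, ∀ k` (one exponent `(mt+2)^C` for every number `k` of products)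
is FALSE.  Witness = KPTT arXiv:1308.2286 Example 3 + Lemma 2 + Prop. 1 (p. 7) made explicit: the digit
grids `P_j = {(b^{2j} i, b^j i') : i < b², i' < b}` (`#P_j ≤ b³ = t`) are DISSOCIATED (unique digit
expansions, `digitGrid_dissociated`), their sum is the box `[0, b^{2m}) × [0, b^m)`, which contains the
`b^m` chain points `(y(y-1)/2, y)` in strictly convex position, each realised by ONE product of monomials
(`k = b^m`, `sum_prod_digit_monomials`); with `m = 3C+3`, `b = (3C+5)^C + 1` the vertex count
`b^m = t^{C+1}` beats `(mt+2)^C` (`uniformC_arith`).  Consequence for the crux: its exponent `C(k)` must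
tend to infinity (`C(k) ≳ log k / log log k`), while the disprover's blueprint proves `C(k) = O(k)`; the
gap is exactly the sibling crux `DissociatedUniform` (stmt-5905).
[cite arXiv:1308.2286 Example 3, Lemma 2, Proposition 1]
Base-`B` digits are `Literature.Computability.Complexity.Expander.RotGraph.digit` (reused, not redefined).
-/

namespace Summit.ValiantsHypothesis.ValiantsHypothesis.Theorems.DissociatedFixedK.Negative

open Finset
open Literature.Computability.Complexity.Expander.RotGraph (digit digit_lt)

/-- Digit expansion: `Σ_{j<m} B^j · digit_j(x) = x` for `x < B^m`. [folklore] -/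
theorem sum_pow_mul_digit {B : ℕ} (hB : 0 < B) :
    ∀ (m x : ℕ), x < B ^ m → (∑ j : Fin m, B ^ (j : ℕ) * digit B x j) = x := by
  intro m
  induction m with
  | zero => intro x hx; simp at hx; simp [hx]
  | succ m ih =>
    intro x hx
    rw [Fin.sum_univ_succ]
    simp only [Fin.val_zero, pow_zero, one_mul, Fin.val_succ]
    have hdiv : x / B < B ^ m := by
      rw [Nat.div_lt_iff_lt_mul hB]; simpa [pow_succ] using hx
    have key : ∀ j : Fin m, B ^ ((j : ℕ) + 1) * digit B x ((j : ℕ) + 1) =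
        B * (B ^ (j : ℕ) * digit B (x / B) j) := by
      intro j
      simp only [digit, pow_succ, Nat.div_div_eq_div_mul]
      ring_nf
    rw [Finset.sum_congr rfl (fun j _ => key j), ← Finset.mul_sum, ih (x / B) hdiv]
    simp only [digit, pow_zero, Nat.div_one]
    exact Nat.mod_add_div x B

/-- Uniqueness of digits: two digit vectors (entries `< B`) with the same value are equal. [folklore] -/
theorem digits_unique {B : ℕ} (hB : 0 < B) :
    ∀ (m : ℕ) (d e : Fin m → ℕ), (∀ j, d j < B) → (∀ j, e j < B) →
      (∑ j : Fin m, B ^ (j : ℕ) * d j) = (∑ j : Fin m, B ^ (j : ℕ) * e j) → d = e := by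
  intro m
  induction m with
  | zero => intro d e _ _ _; funext j; exact Fin.elim0 j
  | succ m ih =>
    intro d e hd he h
    rw [Fin.sum_univ_succ, Fin.sum_univ_succ] at h
    simp only [Fin.val_zero, pow_zero, one_mul, Fin.val_succ, pow_succ] at h
    have hsplit : ∀ (c : Fin (m+1) → ℕ),
        (∑ j : Fin m, B ^ (j : ℕ) * B * c j.succ) = B * ∑ j : Fin m, B ^ (j : ℕ) * c j.succ := by
      intro c; rw [Finset.mul_sum]; apply Finset.sum_congr rfl; intro j _; ring
    rw [hsplit d, hsplit e] at h
    -- compare modulo B and divide by B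
    have h0 : d 0 = e 0 := by
      have := congrArg (· % B) h
      simpa [Nat.add_mul_mod_self_left, Nat.mod_eq_of_lt (hd 0), Nat.mod_eq_of_lt (he 0)] using this
    have htail : (∑ j : Fin m, B ^ (j : ℕ) * d j.succ) = (∑ j : Fin m, B ^ (j : ℕ) * e j.succ) := by
      rw [h0] at h
      have h' := Nat.add_left_cancel h
      exact Nat.eq_of_mul_eq_mul_left hB h'
    have := ih (fun j => d j.succ) (fun j => e j.succ) (fun j => hd _) (fun j => he _) htail
    funext j
    refine Fin.cases h0 (fun j => ?_) j
    exact congrFun this j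


/-! ## §C  The strengthening "one exponent `C` for every `k`" is FALSE (KPTT Example 3 / Lemma 2) -/

/-- KPTT Example 3 (arXiv:1308.2286 p. 7): the `j`-th digit grid
`P_j = {(b^{2j} i, b^j i') : i < b², i' < b}`, `#P_j ≤ b³`; `P_0 + ⋯ + P_{m-1}` is the full box
`[0, b^{2m}) × [0, b^m)` with UNIQUE representations (dissociated). [folklore] -/
noncomputable def digitGrid (b j : ℕ) : Finset (Fin 2 →₀ ℕ) :=
  ((Finset.range (b ^ 2)) ×ˢ (Finset.range b)).image
    (fun p => Finsupp.single 0 (b ^ (2 * j) * p.1) + Finsupp.single 1 (b ^ j * p.2))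

/-- `#P_j ≤ b³` (`= t`). [folklore] -/
theorem card_digitGrid_le (b j : ℕ) : (digitGrid b j).card ≤ b ^ 3 := by
  refine Finset.card_image_le.trans ?_
  rw [Finset.card_product, Finset.card_range, Finset.card_range]
  ring_nf
  exact le_rfl

/-- The digit tuple of the chain point `(y(y-1)/2, y)`: its `j`-th entry lies in `P_j`. [folklore] -/
noncomputable def digitPt (b y j : ℕ) : Fin 2 →₀ ℕ :=
  Finsupp.single 0 (b ^ (2 * j) * digit (b ^ 2) (y * (y - 1) / 2) j) +
    Finsupp.single 1 (b ^ j * digit b y j)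

/-- The `j`-th digit tuple entry of a chain point lies in the `j`-th digit grid. [folklore] -/
theorem digitPt_mem (b y j : ℕ) (hb : 0 < b) : digitPt b y j ∈ digitGrid b j := by
  refine Finset.mem_image.mpr ⟨(digit (b ^ 2) (y * (y - 1) / 2) j, digit b y j), ?_, rfl⟩
  simp only [Finset.mem_product, Finset.mem_range]
  exact ⟨digit_lt (by positivity) _ _, digit_lt hb _ _⟩

/-- The first coordinate `y(y-1)/2` of a chain point with `y < b^m` fits in `m` base-`b²` digits. [folklore] -/
theorem chainX_lt {b m y : ℕ} (hy : y < b ^ m) : y * (y - 1) / 2 < (b ^ 2) ^ m := by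
  have h1 : y * (y - 1) / 2 ≤ y * (y - 1) := Nat.div_le_self _ _
  have h2 : y * (y - 1) ≤ y * y := Nat.mul_le_mul_left _ (Nat.sub_le _ _)
  have h3 : y * y < b ^ m * b ^ m := Nat.mul_lt_mul'' hy hy
  rw [← pow_mul, mul_comm 2 m, pow_mul, pow_two]
  omega

/-- The digit tuple of a chain point sums to the chain point (digit expansion in bases `b²` and `b`). [folklore] -/
theorem sum_digitPt {b m : ℕ} (hb : 0 < b) (y : ℕ) (hy : y < b ^ m) :
    (∑ j : Fin m, digitPt b y j) = chainPt y := by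
  simp only [digitPt, Finset.sum_add_distrib, ← Finsupp.single_finsetSum, chainPt]
  congr 1
  · congr 1
    have := sum_pow_mul_digit (B := b ^ 2) (by positivity) m (y * (y - 1) / 2) (chainX_lt hy)
    refine Eq.trans ?_ this
    apply Finset.sum_congr rfl
    intro j _
    rw [← pow_mul]
  · congr 1
    exact sum_pow_mul_digit hb m y hy

/-- A product of coefficient-one monomials is the monomial of the exponent sum. [folklore] -/
theorem prod_monomial_one {σ R : Type*} [CommSemiring R] :
    ∀ (m : ℕ) (s : Fin m → σ →₀ ℕ),
      (∏ j : Fin m, MvPolynomial.monomial (s j) (1 : R)) = MvPolynomial.monomial (∑ j, s j) 1 := by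
  intro m
  induction m with
  | zero => intro s; simp
  | succ m ih =>
    intro s
    rw [Fin.prod_univ_succ, Fin.sum_univ_succ, ih (fun j => s j.succ), MvPolynomial.monomial_mul, one_mul]

/-- The witness sum of products of monomials IS `chainPoly (range k)` when `k ≤ b^m`. [folklore] -/
theorem sum_prod_digit_monomials {b m k : ℕ} (hb : 0 < b) (hk : k ≤ b ^ m) :
    (∑ y : Fin k, ∏ j : Fin m, MvPolynomial.monomial (digitPt b y j) (1 : ℂ)) =
      chainPoly (Finset.range k) := by
  have : ∀ y : Fin k, (∏ j : Fin m, MvPolynomial.monomial (digitPt b y j) (1 : ℂ)) =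
      MvPolynomial.monomial (chainPt y) 1 := by
    intro y
    rw [prod_monomial_one, sum_digitPt hb (y : ℕ) (lt_of_lt_of_le y.2 hk)]
  simp only [this, chainPoly]
  exact Fin.sum_univ_eq_sum_range (fun y => MvPolynomial.monomial (chainPt y) (1 : ℂ)) k

/-- The digit grids are dissociated: the sum map is injective on `Π_j P_j`. [folklore] -/
theorem digitGrid_dissociated {b : ℕ} (hb : 0 < b) (m : ℕ) (a c : Fin m → (Fin 2 →₀ ℕ))
    (ha : ∀ j : Fin m, a j ∈ digitGrid b j) (hc : ∀ j : Fin m, c j ∈ digitGrid b j)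
    (h : ∑ j, a j = ∑ j, c j) : a = c := by
  choose p hp hpa using fun j => Finset.mem_image.mp (ha j)
  choose q hq hqc using fun j => Finset.mem_image.mp (hc j)
  simp only [Finset.mem_product, Finset.mem_range] at hp hq
  have h0 := congrArg (fun e => e 0) h
  have h1 := congrArg (fun e => e 1) h
  simp only [Finsupp.finsetSum_apply] at h0 h1
  have ha0 : ∀ j, a j 0 = (b ^ 2) ^ (j : ℕ) * (p j).1 := by
    intro j; rw [← hpa j, ← pow_mul]; simp
  have ha1 : ∀ j, a j 1 = b ^ (j : ℕ) * (p j).2 := by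
    intro j; rw [← hpa j]; simp
  have hc0 : ∀ j, c j 0 = (b ^ 2) ^ (j : ℕ) * (q j).1 := by
    intro j; rw [← hqc j, ← pow_mul]; simp
  have hc1 : ∀ j, c j 1 = b ^ (j : ℕ) * (q j).2 := by
    intro j; rw [← hqc j]; simp
  simp only [ha0, hc0] at h0
  simp only [ha1, hc1] at h1
  have e1 := digits_unique (B := b ^ 2) (by positivity) m (fun j => (p j).1) (fun j => (q j).1)
    (fun j => (hp j).1) (fun j => (hq j).1) h0
  have e2 := digits_unique hb m (fun j => (p j).2) (fun j => (q j).2)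
    (fun j => (hp j).2) (fun j => (hq j).2) h1
  funext j
  rw [← hpa j, ← hqc j, show (p j).1 = (q j).1 from congrFun e1 j,
    show (p j).2 = (q j).2 from congrFun e2 j]

/-- The arithmetic of the witness: with `m = 3C+3`, `b = (3C+5)^C + 1`, `t = b³`:
`(m t + 2)^C < b^m` (`= t^{C+1}`, the number of chain points). [folklore] -/
theorem uniformC_arith (C : ℕ) :
    ((3 * C + 3) * ((3 * C + 5) ^ C + 1) ^ 3 + 2) ^ C < ((3 * C + 5) ^ C + 1) ^ (3 * C + 3) := by
  set b := (3 * C + 5) ^ C + 1 with hb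
  set m := 3 * C + 3 with hm
  have hb1 : 1 ≤ b := by simp [hb]
  have ht1 : 1 ≤ b ^ 3 := Nat.one_le_pow _ _ hb1
  have h1 : m * b ^ 3 + 2 ≤ (m + 2) * b ^ 3 := by nlinarith
  have h2 : (m * b ^ 3 + 2) ^ C ≤ ((m + 2) * b ^ 3) ^ C := Nat.pow_le_pow_left h1 C
  have h4 : (m + 2) ^ C < b := by simp [hb, hm]
  have h5 : ((m + 2) * b ^ 3) ^ C = (m + 2) ^ C * (b ^ 3) ^ C := Nat.mul_pow _ _ _
  have h6 : (m + 2) ^ C * (b ^ 3) ^ C < b * (b ^ 3) ^ C :=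
    Nat.mul_lt_mul_of_pos_right h4 (by positivity)
  have h7 : b * (b ^ 3) ^ C = b ^ (3 * C + 1) := by rw [← pow_mul, pow_succ']
  have h8 : b ^ (3 * C + 1) ≤ b ^ (3 * C + 3) := Nat.pow_le_pow_right hb1 (by omega)
  calc (m * b ^ 3 + 2) ^ C ≤ ((m + 2) * b ^ 3) ^ C := h2
    _ = (m + 2) ^ C * (b ^ 3) ^ C := h5
    _ < b * (b ^ 3) ^ C := h6
    _ = b ^ (3 * C + 1) := h7
    _ ≤ b ^ (3 * C + 3) := h8

/-- **The uniform-exponent strengthening of `DissociatedFixedK` is false** (KPTT arXiv:1308.2286,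
Example 3 + Lemma 2, p. 7, made explicit): for every `C`, the dissociated digit grids with
`b = (3C+5)^C + 1`, `t = b³`, `m = 3C+3` factors and `k = b^m` products of MONOMIALS realise the
`b^m = t^{C+1}` chain points `(y(y-1)/2, y)`, `y < b^m`, all of which are vertices; and
`t^{C+1} > (mt+2)^C`.  Hence in the crux the exponent `C = C(k)` must tend to infinity with `k`
(quantitatively `(8 log₂k + 2)^{C(k)} ≥ k` taking `b = 2`, i.e. `C(k) ≳ log k / log log k`), while the
blueprint proves `C(k) = O(k)`; the gap is the sibling crux `DissociatedUniform`. [folklore] -/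
theorem not_dissociatedFixedKUniformC : ¬ Literature.Uncategorized.DissociatedFixedKUniformC := by
  rintro ⟨C, hC⟩
  set b := (3 * C + 5) ^ C + 1 with hb
  set m := 3 * C + 3 with hm
  have hb0 : 0 < b := by simp [hb]
  have hle := hC (b ^ m) m (b ^ 3) (fun j => digitGrid b j)
    (fun y j => MvPolynomial.monomial (digitPt b y j) 1)
    (fun j => card_digitGrid_le b j)
    (fun y j => (MvPolynomial.support_monomial_subset).trans
      (Finset.singleton_subset_iff.mpr (digitPt_mem b y j hb0)))
    (fun a c ha hc h => digitGrid_dissociated hb0 m a c ha hc h)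
  rw [sum_prod_digit_monomials hb0 le_rfl, vertices_chainPoly, Finset.card_range] at hle
  exact absurd (uniformC_arith C) (not_lt.mpr hle)

end Summit.ValiantsHypothesis.ValiantsHypothesis.Theorems.DissociatedFixedK.Negative
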